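import Summits.BirchSwinnertonDyer.BirchSwinnertonDyer.Theorems.PrintCf2SplitBadTwoLocalControlKernelDyadicOdd
import Summits.BirchSwinnertonDyer.BirchSwinnertonDyer.Theorems.PrintCf2SplitBadTwoCMPrimaryDyadicZetaEight
import HarnessLib

/-!
# Crux `PrintCf2.SplitBadTwoRankOneOfFacts` (stmt-BirchSwinnertonDyer-20368), road α v10.3 — brick B15 file 11: (R-DYADIC) FOR EVEN `d` WITH A MOVER,
# from (C3-loc): `#LK_{v̄} = 2` on the keys (0,1), (0,5) (`d = 2d'`, `d' ≡ 1 (4)`) and (0,3) (`d' ≡ 3 (8)`)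

Cell `bsd-print-cf2`, width seat `bsd-line-cf2-p1-w2` g9 (prover-bsd-line-cf2-p1-w2-g9-0); brick B15 (memo `Cruxes/SplitBadTwoRankOneOfFacts/B15-DYADIC-EXACT-w2g9.md`
§3); `--supports stmt-BirchSwinnertonDyer-20368` (helper, Theses-free). HONEST FRAMING: nothing here closes the crux or a registered stub; BSD is not
proved by any of this; no summit statement is proved by this seat. No definition, no named fact, no `sorry`. Sequel of files 9–10.

WHAT. S3c frame, `W* = E[𝔮_r^∞]` pinned at `v` (kernel type at `v̄`), `d = 2d'` even squarefree, (C3-loc) as in file 9. An element of `D_{v̄}` acting as `−1`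
on ALL of `W*` is exhibited, so (Hv̄-move) holds, `D_{v̄} ⊄ ker κ'` (an `ε = 3` inertia element acts as `±3`), and `#LK_{v̄} = 2` (p664385):
* `smul_eq_intCast_mul_of_sq_eq` — signs multiply along `ι√d = ±X·Y` (`(XY)² = (ι√d)²`); `zmod_eight_unitRoot` (`α ≡ 3 (mod 8)`).
* **`natCard_localKer_vbar_eq_two_of_frame_of_kerC3_even_one`** (`d' ≡ 1 (4)`, keys (0,1), (0,5)): `τ` inertia with `ε(τ) = −1`: it fixes `ι√2` (`ε ≡ 7 (8)`,
  p665535) and `√d'` (file 5 (U1)), so `s = +1` and `χ(τ) = s·ε = −1`.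
* **`natCard_localKer_vbar_eq_two_of_frame_of_kerC3_even_three`** (`d' ≡ 3 (8)`, key (0,3)): `σ = φ·τ` with `ε(σ) = α` (`≡ 3 (8)`): `σ` fixes `ι√(−2)`
  (p665535), `φ` negates and `τ` fixes `√(−d')` (`−d' ≡ 5 (8)`, file 5), so `s = −1` on `ι√d = ±ι√(−2)·√(−d')` and `χ(σ) = s·ε(σ)·α⁻¹ = −1`.
The remaining key (0,7) ((Hv̄-triv): `im χ ⊆ {1, 3 mod 8}`) is the last open row. presearch: as files 9–10 — held; no fact filed. beyond-print theorem: no.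

References: [Rubin1999] §3 Lemma 3.6 (ii), Cor. 3.17; [Agboola2007] §3 Prop. 3.2; [SerreAbelianLadic1968] Ch. I §1.2.
-/

noncomputable section

open scoped Classical

set_option linter.dupNamespace false
set_option autoImplicit false

namespace Summit.BirchSwinnertonDyer.BirchSwinnertonDyer.Theorems.PrintCf2.RestrictedSelmerPair

open NumberField IsDedekindDomain Field WeierstrassCurve
open Literature.NumberTheory.EllipticCurves Literature.NumberTheory.EllipticCurves.GreenbergSelmer
open Literature.NumberTheory.GaloisRepresentations
open Summit.BirchSwinnertonDyer.BirchSwinnertonDyer.Theorems.PrintCf2.AdditiveAtSeven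
open Summit.BirchSwinnertonDyer.BirchSwinnertonDyer.Theorems.PrintCf2.CMPrimes

variable {K : Type} [Field K] [NumberField K]

omit [NumberField K] in
/-- Signs multiply along a factorisation `ι√d = ±X·Y`: if `(X·Y)² = A²`, `g • X = s_X X`, `g • Y = s_Y Y` then `g • A = (s_X s_Y) A`. [folklore] -/
theorem smul_eq_intCast_mul_of_sq_eq (g : absoluteGaloisGroup K) {A X Y : AlgebraicClosure K} {sX sY : ℤ} (hXY : (X * Y) ^ 2 = A ^ 2)
    (hX : g • X = (sX : AlgebraicClosure K) * X) (hY : g • Y = (sY : AlgebraicClosure K) * Y) :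
    g • A = ((sX * sY : ℤ) : AlgebraicClosure K) * A := by
  rcases sq_eq_sq_iff_eq_or_eq_neg.mp hXY with h | h
  · rw [← h, smul_mul', hX, hY]; push_cast; ring
  · have hA : A = -(X * Y) := by rw [h, neg_neg]
    rw [hA, smul_neg, smul_mul', hX, hY]; push_cast; ring

/-- `α ≡ 3 (mod 8)` for the unit root of `X² − X + 2`: a unit `t` of `ℤ/8` with `t² = t − 2` is `3`. [folklore] -/
theorem zmod_eight_unitRoot : ∀ t t' : ZMod (2 ^ 3), t * t' = 1 → t ^ 2 = t - 2 → t = 3 := by decide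

/-- **(R-DYADIC) on the keys (0,1), (0,5) from (C3-loc): `#LK_{v̄} = 2`** (`d = 2d'`, `d' ≡ 1 (mod 4)`): the inertia element with `ε = −1` fixes `ι√2`
(`ε ≡ 7 (8)`) and `√d'` (file 5 (U1)), hence `ι√d`, and acts on `W*` as `s·ε = −1`; by (C3-loc) it lies in `ker κ'` and moves `W*[4]`; an `ε = 3` inertia
element acts as `±3`, so `D_{v̄} ⊄ ker κ'`. [cite: Agboola2007, §3 Prop. 3.2] [cite: Rubin1999, §3 Lemma 3.6 (ii) and Cor. 3.17] -/
theorem natCard_localKer_vbar_eq_two_of_frame_of_kerC3_even_one {d : ℤ} (hd0 : d ≠ 0) (hsq : Squarefree d) (h2d : (2 : ℤ) ∣ d) (hd1 : (d / 2) % 4 = 1) (W : WeierstrassCurve ℚ) [W.IsElliptic]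
    (C : VariableChange ℚ) (hC : C • W = cm7.quadraticTwist (d : ℚ)) (hK : IsImaginaryQuadratic K)
    (v vbar : HeightOneSpectrum (𝓞 K)) (hv : ((2 : ℕ) : 𝓞 K) ∈ v.asIdeal) (hvbar : ((2 : ℕ) : 𝓞 K) ∈ vbar.asIdeal)
    (hne : vbar ≠ v) (π : (W.baseChange K).endRing) (hrel : (π : AddMonoid.End (W.baseChange K).geomPoints) * π = π - 2)
    {r : ℤ_[2]} (hr : r * r = r - 2)
    (hclause : ∀ τ ∈ GreenbergSelmer.inertia v, ∀ x : ↥((W.baseChange K).endEigenPrimaryTorsion 2 π r), τ • x = x ∨ τ • x = -x)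
    (κ' : ZpExtension K 2)
    (hC3 : ∀ σ ∈ decomp vbar, σ ∈ κ'.kerSubgroup ↔
      ((∀ x : ↥((W.baseChange K).endEigenPrimaryTorsion 2 π r), σ • x = x) ∨
        (∀ x : ↥((W.baseChange K).endEigenPrimaryTorsion 2 π r), σ • x = -x))) :
    Nat.card (resOfLe ↥((W.baseChange K).endEigenPrimaryTorsion 2 π r)
        (inf_le_inf_right (decomp vbar) (le_top : κ'.kerSubgroup ≤ ⊤))).ker = 2 := by
  haveI : Fact (Nat.Prime 2) := ⟨Nat.prime_two⟩
  have hj : W.j = -3375 := j_eq_of_smul_eq_cm7Twist hd0 W C hC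
  obtain ⟨θ, hθ⟩ := exists_sq_eq_neg_seven_of_cmEndo_mem_endRing W K hj π hrel
  have hK2 : Module.finrank ℚ K = 2 := hK.1
  obtain ⟨-, -, -, -, -, -, hgen, -⟩ := endEigenPrimaryTorsion_two_structure W hj K hθ π hrel hr
  -- the kernel-type clause (R) at `v̄` for `E[𝔮_r^∞]`
  obtain ⟨hcl', -⟩ := endEigenPrimaryTorsion_two_pinningClause_swap W K hj hK hθ π hrel hr hv hvbar hne hclause
  have hcl'' : ∀ τ ∈ GreenbergSelmer.inertia vbar, ∀ y ∈ (W.baseChange K).endEigenPrimaryTorsion 2 π (1 - r),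
      τ • y = y ∨ τ • y = -y := fun τ hτ y hy ↦ by
    rcases hcl' τ hτ ⟨y, hy⟩ with h | h
    · exact Or.inl (congrArg Subtype.val h)
    · exact Or.inr (congrArg Subtype.val h)
  have h1r : (1 - r) * (1 - r) = (1 - r) - 2 := by linear_combination hr
  have hdQ : (d : ℚ) ≠ 0 := by exact_mod_cast hd0
  obtain ⟨α, hα, -, hUR⟩ := endEigenPrimaryTorsion_two_localTypes_named_of_pinned W K hj hθ π hrel h1r hdQ C hC vbar hvbar
    (inertiaDeg_eq_one_of_ne_two K hK2 hvbar hv hne.symm) hcl''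
  simp only [sub_sub_cancel] at hUR
  have HR := fun σ n hσ s hs ↦ (hUR σ n hσ s hs).2
  -- Step 1: `D_{v̄} ⊄ ker κ'` — an inertia element with `ε = 3` acts as `−3`
  have hu3 : IsUnit ((3 : ℤ) : ℤ_[2]) := by
    rw [PadicInt.isUnit_iff]
    refine le_antisymm (PadicInt.norm_le_one _) (not_lt.mp fun hlt ↦ ?_)
    have h3 : (2 : ℤ) ∣ 3 := by exact_mod_cast (PadicInt.norm_int_lt_one_iff_dvd (p := 2) 3).mp hlt
    omega
  obtain ⟨g3, hg3, hord3, -⟩ := hgen 3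
  have hw : ¬ decomp vbar ≤ κ'.kerSubgroup := by
    obtain ⟨τ, hτI, hτχ⟩ := ZpExtension.exists_mem_inertia_cyclotomicCharacter_eq_of_split hK2 hv hvbar hne
      (adicCompletionPrime_mem_primesAbove K vbar) hu3.unit
    rw [inertia_adicCompletionPrime_eq_map_absInertia K vbar, Subgroup.mem_map] at hτI
    obtain ⟨σ, hσI, hστ⟩ := hτI
    have hτχ' : GaloisRep.cyclotomicCharacter K 2 (absGaloisRestrict K (vbar.adicCompletion K) σ) = hu3.unit := by rw [← hτχ]; exact congrArg _ hστ
    have hσ0 : IsFrobPow σ ((0 : ℕ) : ℤ) := by exact_mod_cast isFrobPow_zero_iff_mem_absInertia.mpr hσI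
    intro hle
    have hmem : absGaloisRestrict K (vbar.adicCompletion K) σ ∈ κ'.kerSubgroup := hle ⟨σ, rfl⟩
    have h8 : 2 ^ 3 • g3 = 0 := by rw [← hord3]; exact addOrderOf_nsmul_eq_zero g3
    -- the sign `s` of `res σ` on `ι√d` and the action `3s` on `W*[8]`
    obtain ⟨s, hs, hs1⟩ : ∃ s : ℤ, ((absGaloisRestrict K (vbar.adicCompletion K) σ • absClosureEmbedding ℚ K (WeierstrassCurve.geomSqrt (d : ℚ)) =
          absClosureEmbedding ℚ K (WeierstrassCurve.geomSqrt (d : ℚ)) ∧ s = 1) ∨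
        (absGaloisRestrict K (vbar.adicCompletion K) σ • absClosureEmbedding ℚ K (WeierstrassCurve.geomSqrt (d : ℚ)) =
          -absClosureEmbedding ℚ K (WeierstrassCurve.geomSqrt (d : ℚ)) ∧ s = -1)) ∧ (s = 1 ∨ s = -1) := by
      rcases smul_absClosureEmbedding_geomSqrt_eq_or K (d : ℚ) (absGaloisRestrict K (vbar.adicCompletion K) σ) with hA | hA
      · exact ⟨1, Or.inl ⟨hA, rfl⟩, Or.inl rfl⟩
      · exact ⟨-1, Or.inr ⟨hA, rfl⟩, Or.inr rfl⟩
    have hact := HR σ 0 hσ0 s hs 3 g3 hg3 h8 (3 * s) (by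
      have h0 : (((3 * s : ℤ)) : ℤ_[2]) - s * ((GaloisRep.cyclotomicCharacter K 2
          (absGaloisRestrict K (vbar.adicCompletion K) σ) * (α⁻¹) ^ 0 : ℤ_[2]ˣ) : ℤ_[2]) = 0 := by
        rw [pow_zero, mul_one, hτχ', IsUnit.unit_spec]; push_cast; ring
      rw [h0]; exact Ideal.zero_mem _)
    have hN : 3 * s = 3 ∨ 3 * s = -3 := by rcases hs1 with rfl | rfl <;> norm_num
    rcases (hC3 _ ⟨σ, rfl⟩).mp hmem with h | h
    · exact false_of_smul_eq_three_of_smul_eq_pm hord3 hN hact (Or.inl (congrArg Subtype.val (h ⟨g3, hg3⟩)))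
    · exact false_of_smul_eq_three_of_smul_eq_pm hord3 hN hact (Or.inr (congrArg Subtype.val (h ⟨g3, hg3⟩)))
  -- Step 2: `d = 2d'`, `d'` odd, `d' ≡ 1 (mod 4)`
  obtain ⟨d', rfl⟩ := h2d
  have hd'1 : d' % 4 = 1 := by omega
  -- Step 3: the inertia element with `ε = −1`
  have hum1 : IsUnit ((-1 : ℤ) : ℤ_[2]) := by rw [Int.cast_neg, Int.cast_one]; exact isUnit_one.neg
  obtain ⟨τ, hτI, hτχ⟩ := ZpExtension.exists_mem_inertia_cyclotomicCharacter_eq_of_split hK2 hv hvbar hne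
    (adicCompletionPrime_mem_primesAbove K vbar) hum1.unit
  rw [inertia_adicCompletionPrime_eq_map_absInertia K vbar, Subgroup.mem_map] at hτI
  obtain ⟨στ, hστI, hσττ⟩ := hτI
  have hε : ((GaloisRep.cyclotomicCharacter K 2 (absGaloisRestrict K (vbar.adicCompletion K) στ) : ℤ_[2]ˣ) : ℤ_[2]) = -1 := by
    have h := congrArg (fun u : ℤ_[2]ˣ ↦ (u : ℤ_[2])) hτχ
    simp only [IsUnit.unit_spec, Int.cast_neg, Int.cast_one] at h
    rw [← h]; exact congrArg (fun g ↦ ((GaloisRep.cyclotomicCharacter K 2 g : ℤ_[2]ˣ) : ℤ_[2])) hσττ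
  have hτ0 : IsFrobPow στ ((0 : ℕ) : ℤ) := by exact_mod_cast isFrobPow_zero_iff_mem_absInertia.mpr hστI
  -- signs: `ι√2` fixed (`ε ≡ 7 (8)`), `√d'` fixed (U1), so `ι√d` fixed
  have hX : absGaloisRestrict K (vbar.adicCompletion K) στ • absClosureEmbedding ℚ K (WeierstrassCurve.geomSqrt (2 : ℚ)) =
      ((1 : ℤ) : AlgebraicClosure K) * absClosureEmbedding ℚ K (WeierstrassCurve.geomSqrt (2 : ℚ)) := by
    rw [Int.cast_one, one_mul]
    refine (smul_geomSqrt_two_eq_of_cyclotomicCharacter K _).1 (Or.inr ?_)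
    rw [hε, map_neg, map_one]
    decide
  have hY : absGaloisRestrict K (vbar.adicCompletion K) στ • WeierstrassCurve.geomSqrt ((d' : ℤ) : K) =
      ((1 : ℤ) : AlgebraicClosure K) * WeierstrassCurve.geomSqrt ((d' : ℤ) : K) := by
    rw [Int.cast_one, one_mul]
    exact smul_geomSqrt_eq_of_mem_absInertia_of_emod_four_eq_one vbar hvbar hd'1 hστI
  have hXY : (absClosureEmbedding ℚ K (WeierstrassCurve.geomSqrt (2 : ℚ)) * WeierstrassCurve.geomSqrt ((d' : ℤ) : K)) ^ 2 =
      absClosureEmbedding ℚ K (WeierstrassCurve.geomSqrt ((2 * d' : ℤ) : ℚ)) ^ 2 := by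
    rw [mul_pow, ← map_pow, ← map_pow, WeierstrassCurve.geomSqrt_sq, WeierstrassCurve.geomSqrt_sq, WeierstrassCurve.geomSqrt_sq,
      AlgHom.commutes, AlgHom.commutes]
    simp only [map_intCast, map_ofNat, map_mul, Int.cast_mul, Int.cast_ofNat]
  have hA := smul_eq_intCast_mul_of_sq_eq _ hXY hX hY
  rw [show ((1 * 1 : ℤ) : AlgebraicClosure K) = 1 by norm_num, one_mul] at hA
  -- `res τ` acts as `−1` on all of `W*`
  have hneg : ∀ x : ↥((W.baseChange K).endEigenPrimaryTorsion 2 π r), absGaloisRestrict K (vbar.adicCompletion K) στ • x = -x := by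
    intro x
    obtain ⟨k, hk⟩ := (AddCommGroup.mem_primaryComponent).mp (x : (W.baseChange K).geomPrimaryTorsion 2).2
    have hxk : 2 ^ k • (x : (W.baseChange K).geomPrimaryTorsion 2) = 0 :=
      Subtype.ext (by rw [AddSubmonoidClass.coe_nsmul, ZeroMemClass.coe_zero]; exact hk)
    have hmem : (((-1 : ℤ) : ℤ_[2]) - (1 : ℤ) * ((GaloisRep.cyclotomicCharacter K 2 (absGaloisRestrict K (vbar.adicCompletion K) στ) * (α⁻¹) ^ 0 :
        ℤ_[2]ˣ) : ℤ_[2])) ∈ (Ideal.span {(2 : ℤ_[2]) ^ k} : Ideal ℤ_[2]) := by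
      rw [pow_zero, mul_one, hε]; simp
    have h := HR στ 0 hτ0 1 (Or.inl ⟨by exact_mod_cast hA, rfl⟩) k x x.2 hxk (-1) hmem
    exact Subtype.ext (by rw [neg_one_zsmul] at h; exact h)
  -- conclusion: (Hv̄-move) and `#LK_{v̄} = 2`
  have hker : absGaloisRestrict K (vbar.adicCompletion K) στ ∈ κ'.kerSubgroup := (hC3 _ ⟨στ, rfl⟩).mpr (Or.inr hneg)
  obtain ⟨g, hg, hord, -⟩ := hgen 2
  have hg4 : 4 • g = 0 := by rw [show (4 : ℕ) = 2 ^ 2 from rfl, ← hord]; exact addOrderOf_nsmul_eq_zero g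
  have hg2 : 2 • g ≠ 0 := fun h ↦ by
    have hdvd : addOrderOf g ∣ 2 := addOrderOf_dvd_of_nsmul_eq_zero h
    rw [hord] at hdvd
    exact absurd (Nat.le_of_dvd two_pos hdvd) (by norm_num)
  have hmove : ∃ σ ∈ κ'.kerSubgroup ⊓ decomp vbar, ∃ x : ↥((W.baseChange K).endEigenPrimaryTorsion 2 π r), 4 • x = 0 ∧ σ • x ≠ x := by
    refine ⟨absGaloisRestrict K (vbar.adicCompletion K) στ, ⟨hker, ⟨στ, rfl⟩⟩, ⟨g, hg⟩, Subtype.ext (by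
      rw [AddSubmonoidClass.coe_nsmul, ZeroMemClass.coe_zero]; exact hg4), fun h ↦ hg2 ?_⟩
    rw [hneg] at h
    have h' := congrArg Subtype.val h
    change -g = g at h'
    rw [two_nsmul]
    exact add_eq_zero_iff_eq_neg.mpr h'.symm
  exact natCard_localKer_vbar_eq_two_of_frame hd0 W C hC vbar π hrel hr κ' hmove hw

/-- **(R-DYADIC) on the key (0,3) from (C3-loc): `#LK_{v̄} = 2`** (`d = 2d'`, `d' ≡ 3 (mod 8)`): `σ = φ·τ` with `ε(σ) = α ≡ 3 (8)` fixes `ι√(−2)`, while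
`φ` negates and `τ` fixes `√(−d')` (`−d' ≡ 5 (8)`, file 5), so `σ` has sign `−1` on `ι√d = ±ι√(−2)·√(−d')` and acts as `s·ε·α⁻¹ = −1` on `W*`.
[cite: Agboola2007, §3 Prop. 3.2] [cite: Rubin1999, §3 Lemma 3.6 (ii) and Cor. 3.17] -/
theorem natCard_localKer_vbar_eq_two_of_frame_of_kerC3_even_three {d : ℤ} (hd0 : d ≠ 0) (hsq : Squarefree d) (h2d : (2 : ℤ) ∣ d) (hd3 : (d / 2) % 8 = 3) (W : WeierstrassCurve ℚ) [W.IsElliptic]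
    (C : VariableChange ℚ) (hC : C • W = cm7.quadraticTwist (d : ℚ)) (hK : IsImaginaryQuadratic K)
    (v vbar : HeightOneSpectrum (𝓞 K)) (hv : ((2 : ℕ) : 𝓞 K) ∈ v.asIdeal) (hvbar : ((2 : ℕ) : 𝓞 K) ∈ vbar.asIdeal)
    (hne : vbar ≠ v) (π : (W.baseChange K).endRing) (hrel : (π : AddMonoid.End (W.baseChange K).geomPoints) * π = π - 2)
    {r : ℤ_[2]} (hr : r * r = r - 2)
    (hclause : ∀ τ ∈ GreenbergSelmer.inertia v, ∀ x : ↥((W.baseChange K).endEigenPrimaryTorsion 2 π r), τ • x = x ∨ τ • x = -x)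
    (κ' : ZpExtension K 2)
    (hC3 : ∀ σ ∈ decomp vbar, σ ∈ κ'.kerSubgroup ↔
      ((∀ x : ↥((W.baseChange K).endEigenPrimaryTorsion 2 π r), σ • x = x) ∨
        (∀ x : ↥((W.baseChange K).endEigenPrimaryTorsion 2 π r), σ • x = -x))) :
    Nat.card (resOfLe ↥((W.baseChange K).endEigenPrimaryTorsion 2 π r)
        (inf_le_inf_right (decomp vbar) (le_top : κ'.kerSubgroup ≤ ⊤))).ker = 2 := by
  haveI : Fact (Nat.Prime 2) := ⟨Nat.prime_two⟩
  have hj : W.j = -3375 := j_eq_of_smul_eq_cm7Twist hd0 W C hC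
  obtain ⟨θ, hθ⟩ := exists_sq_eq_neg_seven_of_cmEndo_mem_endRing W K hj π hrel
  have hK2 : Module.finrank ℚ K = 2 := hK.1
  obtain ⟨-, -, -, -, -, -, hgen, -⟩ := endEigenPrimaryTorsion_two_structure W hj K hθ π hrel hr
  -- the kernel-type clause (R) at `v̄` for `E[𝔮_r^∞]`
  obtain ⟨hcl', -⟩ := endEigenPrimaryTorsion_two_pinningClause_swap W K hj hK hθ π hrel hr hv hvbar hne hclause
  have hcl'' : ∀ τ ∈ GreenbergSelmer.inertia vbar, ∀ y ∈ (W.baseChange K).endEigenPrimaryTorsion 2 π (1 - r),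
      τ • y = y ∨ τ • y = -y := fun τ hτ y hy ↦ by
    rcases hcl' τ hτ ⟨y, hy⟩ with h | h
    · exact Or.inl (congrArg Subtype.val h)
    · exact Or.inr (congrArg Subtype.val h)
  have h1r : (1 - r) * (1 - r) = (1 - r) - 2 := by linear_combination hr
  have hdQ : (d : ℚ) ≠ 0 := by exact_mod_cast hd0
  obtain ⟨α, hα, -, hUR⟩ := endEigenPrimaryTorsion_two_localTypes_named_of_pinned W K hj hθ π hrel h1r hdQ C hC vbar hvbar
    (inertiaDeg_eq_one_of_ne_two K hK2 hvbar hv hne.symm) hcl''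
  simp only [sub_sub_cancel] at hUR
  have HR := fun σ n hσ s hs ↦ (hUR σ n hσ s hs).2
  -- Step 1: `D_{v̄} ⊄ ker κ'` — an inertia element with `ε = 3` acts as `−3`
  have hu3 : IsUnit ((3 : ℤ) : ℤ_[2]) := by
    rw [PadicInt.isUnit_iff]
    refine le_antisymm (PadicInt.norm_le_one _) (not_lt.mp fun hlt ↦ ?_)
    have h3 : (2 : ℤ) ∣ 3 := by exact_mod_cast (PadicInt.norm_int_lt_one_iff_dvd (p := 2) 3).mp hlt
    omega
  obtain ⟨g3, hg3, hord3, -⟩ := hgen 3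
  have hw : ¬ decomp vbar ≤ κ'.kerSubgroup := by
    obtain ⟨τ, hτI, hτχ⟩ := ZpExtension.exists_mem_inertia_cyclotomicCharacter_eq_of_split hK2 hv hvbar hne
      (adicCompletionPrime_mem_primesAbove K vbar) hu3.unit
    rw [inertia_adicCompletionPrime_eq_map_absInertia K vbar, Subgroup.mem_map] at hτI
    obtain ⟨σ, hσI, hστ⟩ := hτI
    have hτχ' : GaloisRep.cyclotomicCharacter K 2 (absGaloisRestrict K (vbar.adicCompletion K) σ) = hu3.unit := by rw [← hτχ]; exact congrArg _ hστ
    have hσ0 : IsFrobPow σ ((0 : ℕ) : ℤ) := by exact_mod_cast isFrobPow_zero_iff_mem_absInertia.mpr hσI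
    intro hle
    have hmem : absGaloisRestrict K (vbar.adicCompletion K) σ ∈ κ'.kerSubgroup := hle ⟨σ, rfl⟩
    have h8 : 2 ^ 3 • g3 = 0 := by rw [← hord3]; exact addOrderOf_nsmul_eq_zero g3
    -- the sign `s` of `res σ` on `ι√d` and the action `3s` on `W*[8]`
    obtain ⟨s, hs, hs1⟩ : ∃ s : ℤ, ((absGaloisRestrict K (vbar.adicCompletion K) σ • absClosureEmbedding ℚ K (WeierstrassCurve.geomSqrt (d : ℚ)) =
          absClosureEmbedding ℚ K (WeierstrassCurve.geomSqrt (d : ℚ)) ∧ s = 1) ∨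
        (absGaloisRestrict K (vbar.adicCompletion K) σ • absClosureEmbedding ℚ K (WeierstrassCurve.geomSqrt (d : ℚ)) =
          -absClosureEmbedding ℚ K (WeierstrassCurve.geomSqrt (d : ℚ)) ∧ s = -1)) ∧ (s = 1 ∨ s = -1) := by
      rcases smul_absClosureEmbedding_geomSqrt_eq_or K (d : ℚ) (absGaloisRestrict K (vbar.adicCompletion K) σ) with hA | hA
      · exact ⟨1, Or.inl ⟨hA, rfl⟩, Or.inl rfl⟩
      · exact ⟨-1, Or.inr ⟨hA, rfl⟩, Or.inr rfl⟩
    have hact := HR σ 0 hσ0 s hs 3 g3 hg3 h8 (3 * s) (by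
      have h0 : (((3 * s : ℤ)) : ℤ_[2]) - s * ((GaloisRep.cyclotomicCharacter K 2
          (absGaloisRestrict K (vbar.adicCompletion K) σ) * (α⁻¹) ^ 0 : ℤ_[2]ˣ) : ℤ_[2]) = 0 := by
        rw [pow_zero, mul_one, hτχ', IsUnit.unit_spec]; push_cast; ring
      rw [h0]; exact Ideal.zero_mem _)
    have hN : 3 * s = 3 ∨ 3 * s = -3 := by rcases hs1 with rfl | rfl <;> norm_num
    rcases (hC3 _ ⟨σ, rfl⟩).mp hmem with h | h
    · exact false_of_smul_eq_three_of_smul_eq_pm hord3 hN hact (Or.inl (congrArg Subtype.val (h ⟨g3, hg3⟩)))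
    · exact false_of_smul_eq_three_of_smul_eq_pm hord3 hN hact (Or.inr (congrArg Subtype.val (h ⟨g3, hg3⟩)))
  -- Step 2: `d = 2d'`, `d' ≡ 3 (mod 8)`
  obtain ⟨d', rfl⟩ := h2d
  have hd'3 : d' % 8 = 3 := by omega
  have hq := residueFieldCard_adicCompletion_eq_two_of_frame hd0 W hC hK hθ hvbar
  -- Step 3: `φ` of degree one and the inertia partner `τ` with `ε(τ) = α·ε(φ)⁻¹`
  obtain ⟨φ, hφ1⟩ := exists_isFrobPow_holds (F := vbar.adicCompletion K) 1
  set εφ : ℤ_[2]ˣ := GaloisRep.cyclotomicCharacter K 2 (absGaloisRestrict K (vbar.adicCompletion K) φ) with hεφ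
  obtain ⟨τ, hτI, hτχ⟩ := ZpExtension.exists_mem_inertia_cyclotomicCharacter_eq_of_split hK2 hv hvbar hne
    (adicCompletionPrime_mem_primesAbove K vbar) (α * εφ⁻¹)
  rw [inertia_adicCompletionPrime_eq_map_absInertia K vbar, Subgroup.mem_map] at hτI
  obtain ⟨στ, hστI, hσττ⟩ := hτI
  have hτχ' : GaloisRep.cyclotomicCharacter K 2 (absGaloisRestrict K (vbar.adicCompletion K) στ) = α * εφ⁻¹ := by
    rw [← hτχ]; exact congrArg _ hσττ
  have hεσ : GaloisRep.cyclotomicCharacter K 2 (absGaloisRestrict K (vbar.adicCompletion K) (φ * στ)) = α := by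
    rw [map_mul, map_mul, hτχ', ← hεφ, mul_comm, inv_mul_cancel_right]
  have hσ1 : IsFrobPow (φ * στ) ((1 : ℕ) : ℤ) := by
    have h := IsFrobPow.mul_holds hφ1 (isFrobPow_zero_iff_mem_absInertia.mpr hστI)
    rw [add_zero] at h
    exact_mod_cast h
  -- `α ≡ 3 (mod 8)`
  have hα8 : PadicInt.toZModPow 3 ((α : ℤ_[2]ˣ) : ℤ_[2]) = 3 := by
    refine zmod_eight_unitRoot _ (PadicInt.toZModPow 3 ((α⁻¹ : ℤ_[2]ˣ) : ℤ_[2])) ?_ ?_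
    · rw [← map_mul, ← Units.val_mul, mul_inv_cancel, Units.val_one, map_one]
    · have := congrArg (PadicInt.toZModPow 3) hα
      rwa [map_pow, map_sub, map_ofNat] at this
  -- signs of `σ`: fixes `ι√(−2)`; sign `−1` on `√(−d')`; hence `−1` on `ι√d`
  have hX : absGaloisRestrict K (vbar.adicCompletion K) (φ * στ) • absClosureEmbedding ℚ K (WeierstrassCurve.geomSqrt (-2 : ℚ)) =
      ((1 : ℤ) : AlgebraicClosure K) * absClosureEmbedding ℚ K (WeierstrassCurve.geomSqrt (-2 : ℚ)) := by
    rw [Int.cast_one, one_mul]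
    refine (smul_geomSqrt_neg_two_eq_of_cyclotomicCharacter K _).1 (Or.inr ?_)
    rw [hεσ, hα8]
  have hY : absGaloisRestrict K (vbar.adicCompletion K) (φ * στ) • WeierstrassCurve.geomSqrt ((-d' : ℤ) : K) =
      ((-1 : ℤ) : AlgebraicClosure K) * WeierstrassCurve.geomSqrt ((-d' : ℤ) : K) := by
    rw [map_mul, mul_smul, smul_geomSqrt_eq_of_mem_absInertia_of_emod_four_eq_one vbar hvbar (u := -d') (by omega) hστI,
      smul_geomSqrt_eq_neg_of_isFrobPow_one_of_emod_eight_eq_five vbar hvbar hq (u := -d') (by omega) hφ1]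
    push_cast; ring
  have hXY : (absClosureEmbedding ℚ K (WeierstrassCurve.geomSqrt (-2 : ℚ)) * WeierstrassCurve.geomSqrt ((-d' : ℤ) : K)) ^ 2 =
      absClosureEmbedding ℚ K (WeierstrassCurve.geomSqrt ((2 * d' : ℤ) : ℚ)) ^ 2 := by
    rw [mul_pow, ← map_pow, ← map_pow, WeierstrassCurve.geomSqrt_sq, WeierstrassCurve.geomSqrt_sq, WeierstrassCurve.geomSqrt_sq,
      AlgHom.commutes, AlgHom.commutes]
    simp only [map_intCast, map_neg, map_ofNat, map_mul, Int.cast_mul, Int.cast_ofNat, Int.cast_neg]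
    all_goals ring
  have hA := smul_eq_intCast_mul_of_sq_eq _ hXY hX hY
  rw [show ((1 * -1 : ℤ) : AlgebraicClosure K) = -1 by norm_num, neg_one_mul] at hA
  -- `σ` acts as `−1` on all of `W*`
  have hαinv : (α : ℤ_[2]) * ((α⁻¹ : ℤ_[2]ˣ) : ℤ_[2]) = 1 := by rw [← Units.val_mul, mul_inv_cancel, Units.val_one]
  have hneg : ∀ x : ↥((W.baseChange K).endEigenPrimaryTorsion 2 π r), absGaloisRestrict K (vbar.adicCompletion K) (φ * στ) • x = -x := by
    intro x
    obtain ⟨k, hk⟩ := (AddCommGroup.mem_primaryComponent).mp (x : (W.baseChange K).geomPrimaryTorsion 2).2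
    have hxk : 2 ^ k • (x : (W.baseChange K).geomPrimaryTorsion 2) = 0 :=
      Subtype.ext (by rw [AddSubmonoidClass.coe_nsmul, ZeroMemClass.coe_zero]; exact hk)
    have hmem : (((-1 : ℤ) : ℤ_[2]) - (-1 : ℤ) * ((GaloisRep.cyclotomicCharacter K 2 (absGaloisRestrict K (vbar.adicCompletion K) (φ * στ)) *
        (α⁻¹) ^ 1 : ℤ_[2]ˣ) : ℤ_[2])) ∈ (Ideal.span {(2 : ℤ_[2]) ^ k} : Ideal ℤ_[2]) := by
      rw [hεσ, pow_one, Units.val_mul, hαinv]; simp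
    have h := HR (φ * στ) 1 hσ1 (-1) (Or.inr ⟨by exact_mod_cast hA, rfl⟩) k x x.2 hxk (-1) hmem
    exact Subtype.ext (by rw [neg_one_zsmul] at h; exact h)
  -- conclusion: (Hv̄-move) and `#LK_{v̄} = 2`
  have hker : absGaloisRestrict K (vbar.adicCompletion K) (φ * στ) ∈ κ'.kerSubgroup := (hC3 _ ⟨(φ * στ), rfl⟩).mpr (Or.inr hneg)
  obtain ⟨g, hg, hord, -⟩ := hgen 2
  have hg4 : 4 • g = 0 := by rw [show (4 : ℕ) = 2 ^ 2 from rfl, ← hord]; exact addOrderOf_nsmul_eq_zero g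
  have hg2 : 2 • g ≠ 0 := fun h ↦ by
    have hdvd : addOrderOf g ∣ 2 := addOrderOf_dvd_of_nsmul_eq_zero h
    rw [hord] at hdvd
    exact absurd (Nat.le_of_dvd two_pos hdvd) (by norm_num)
  have hmove : ∃ σ ∈ κ'.kerSubgroup ⊓ decomp vbar, ∃ x : ↥((W.baseChange K).endEigenPrimaryTorsion 2 π r), 4 • x = 0 ∧ σ • x ≠ x := by
    refine ⟨absGaloisRestrict K (vbar.adicCompletion K) (φ * στ), ⟨hker, ⟨(φ * στ), rfl⟩⟩, ⟨g, hg⟩, Subtype.ext (by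
      rw [AddSubmonoidClass.coe_nsmul, ZeroMemClass.coe_zero]; exact hg4), fun h ↦ hg2 ?_⟩
    rw [hneg] at h
    have h' := congrArg Subtype.val h
    change -g = g at h'
    rw [two_nsmul]
    exact add_eq_zero_iff_eq_neg.mpr h'.symm
  exact natCard_localKer_vbar_eq_two_of_frame hd0 W C hC vbar π hrel hr κ' hmove hw

end Summit.BirchSwinnertonDyer.BirchSwinnertonDyer.Theorems.PrintCf2.RestrictedSelmerPair

end
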